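import Mathlib
import Literature.AlgebraicGeometry.Resolution.LocalBlowup
import Literature.AlgebraicGeometry.Resolution.QuadraticTransforms
import Literature.AlgebraicGeometry.Resolution.RegularSystemOfParameters
import Literature.AlgebraicGeometry.Resolution.DerivativeIdeals
import HarnessLib

/-!
# Route `RadicialJung`, crux `CleanModels` (stmt-15917), line `Sketch`: the MORSE EXIT — part 1/2 (algebraic prelims: derivative of a quadratic expression, Euler, the Jacobian argument)

Line lead `res-B-lead-1` g10, `--supports stmt-ResolutionOfSingularities-15917`.  Def-free prelims for `RadicialJungCleanModelsConeExitMorse.lean` (the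
MORSE EXIT: a nondegenerate quadratic END stage of the printed base-side phase is cleaned by ONE quadratic transform, for every valuation).  For a
quadratic expression `q = Σ a_ij T_i T_j` in a commutative algebra `S` with «coordinates» `T` (`T_{i₀} = 1`) and derivations `D_k` (`k ≠ i₀`) killing the
coefficients and with `D_k T_i = δ_ik` — in the application `S = κ[T̃_j : j ≠ i₀]` is the exceptional fibre of the chart of a point blowing up and
`D_k = ∂/∂T̃_k` —:

* `mem_and_derivation_mem_of_mul_mem_sq` — `s q ∈ P²`, `s ∉ P`, `P` prime ⟹ `q ∈ P` and `D q ∈ P` (a derivation maps `P²` into `P`,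
  ✓ `Literature.….Derivation.apply_mem_pow_sub_one`).
* `derivation_quad` — `D_k q = L_k := Σ_j (a_kj + a_jk) T_j`;  `euler_quad` — `Σ_k T_k L_k = 2 q`.
* `mem_of_mul_quad_mem_sq` — THE JACOBIAN ARGUMENT: if the polars span the unit ideal, `Σ β_k L_k = 1` (dehomogenised NONDEGENERACY), then `q` lies in
  no symbolic square of a prime: `s q ∈ P²` ⟹ `s ∈ P`.
* `isQuadraticTransformAlong_chart` (the transform along `O` in the chart of ANY nonzero `x ∈ 𝔪` of minimal value), `rsop_ne_zero`, `symm_mem_sq_comap`.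

Honest framing: OURS · counted 0 · elementary algebra; nothing here proves resolution in characteristic `p`.
-/

noncomputable section

set_option linter.dupNamespace false

open IsLocalRing
open Literature.AlgebraicGeometry.Resolution

namespace Summit.ResolutionOfSingularities.ResolutionOfSingularities.Theorems.RadicialJung.CleanModels.ConeExit

universe u

/-! ## §1 Derivations and symbolic squares of primes -/

/-- **`s · q ∈ P²` with `s ∉ P` forces `q ∈ P` and `D q ∈ P`** for every derivation `D` and prime `P` (a derivation maps `P²` into `P`). [folklore] -/
theorem mem_and_derivation_mem_of_mul_mem_sq {R S : Type*} [CommRing R] [CommRing S] [Algebra R S] (D : Derivation R S S)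
    (P : Ideal S) [P.IsPrime] {s q : S} (hs : s ∉ P) (hsq : s * q ∈ P ^ 2) : q ∈ P ∧ D q ∈ P := by
  have hq : q ∈ P := by
    have : s * q ∈ P := Ideal.pow_le_self two_ne_zero hsq
    exact (Ideal.IsPrime.mem_or_mem ‹_› this).resolve_left hs
  refine ⟨hq, ?_⟩
  have h1 : D (s * q) ∈ P := by
    simpa using Literature.AlgebraicGeometry.Resolution.Derivation.apply_mem_pow_sub_one R D P 2 hsq
  rw [Derivation.leibniz, smul_eq_mul, smul_eq_mul] at h1
  have h2 : s * D q ∈ P := by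
    have : q * D s ∈ P := Ideal.mul_mem_right _ _ hq
    have := Ideal.sub_mem _ h1 this
    rwa [add_sub_cancel_right] at this
  exact (Ideal.IsPrime.mem_or_mem ‹_› h2).resolve_left hs

/-! ## §2 The derivative of a quadratic expression, Euler, and the Jacobian argument -/

section Quad

variable {R S : Type*} [CommRing R] [CommRing S] [Algebra R S] {d : ℕ}

/-- **`D_k (Σ a_ij T_i T_j) = Σ_j (a_kj + a_jk) T_j`** for a derivation killing the `a_ij` with `D_k T_i = δ_ik`. [folklore] -/
theorem derivation_quad (D : Derivation R S S) (a : Fin d → Fin d → S) (T : Fin d → S)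
    (hDa : ∀ i j, D (a i j) = 0) (k : Fin d) (hDT : ∀ i, D (T i) = if i = k then 1 else 0) :
    D (∑ i, ∑ j, a i j * T i * T j) = ∑ j, (a k j + a j k) * T j := by
  classical
  have hD : ∀ i j, D (a i j * T i * T j) =
      (if j = k then a i j * T i else 0) + (if i = k then a i j * T j else 0) := by
    intro i j
    rw [Derivation.leibniz, Derivation.leibniz, hDa, hDT, hDT, smul_zero, add_zero, smul_eq_mul, smul_eq_mul]
    split_ifs <;> ring
  simp only [map_sum, hD, Finset.sum_add_distrib]
  have h1 : ∀ i : Fin d, (∑ j : Fin d, if j = k then a i j * T i else 0) = a i k * T i :=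
    fun i => by rw [Finset.sum_ite_eq' Finset.univ k (fun j => a i j * T i)]; simp
  have h2 : (∑ i : Fin d, ∑ j : Fin d, if i = k then a i j * T j else 0) = ∑ j, a k j * T j := by
    rw [Finset.sum_comm]
    refine Finset.sum_congr rfl fun j _ => ?_
    rw [Finset.sum_ite_eq' Finset.univ k (fun i => a i j * T j)]; simp
  simp only [h1, h2, add_mul, Finset.sum_add_distrib]
  rw [add_comm]

/-- **Euler**: `Σ_k T_k · (Σ_j (a_kj + a_jk) T_j) = 2 · Σ a_ij T_i T_j`. [folklore] -/
theorem euler_quad (a : Fin d → Fin d → S) (T : Fin d → S) :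
    ∑ k, T k * ∑ j, (a k j + a j k) * T j = 2 * ∑ i, ∑ j, a i j * T i * T j := by
  simp only [add_mul, mul_add, Finset.mul_sum, Finset.sum_add_distrib, two_mul]
  congr 1
  · exact Finset.sum_congr rfl fun i _ => Finset.sum_congr rfl fun j _ => by ring
  · rw [Finset.sum_comm]
    exact Finset.sum_congr rfl fun i _ => Finset.sum_congr rfl fun j _ => by ring

/-- **THE JACOBIAN ARGUMENT.**  Let `q = Σ a_ij T_i T_j` with `T_{i₀} = 1`, derivations `D_k` (`k ≠ i₀`) killing the `a_ij` and with `D_k T_i = δ_ik`, and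
suppose the polars `L_k = Σ_j (a_kj + a_jk) T_j` span the unit ideal: `Σ_k β_k L_k = 1` (the dehomogenised form of «the polar forms of a NONDEGENERATE quadratic
form span all linear forms»).  Then `q` lies in no symbolic square of a prime `P` over which `s ∉ P`: from `s q ∈ P²` one gets `q ∈ P`, `L_k = D_k q ∈ P`
(`k ≠ i₀`), `L_{i₀} = 2q - Σ_{k ≠ i₀} T_k L_k ∈ P` (Euler), hence `1 ∈ P`. [folklore] -/
theorem mem_of_mul_quad_mem_sq (a : Fin d → Fin d → S) (T : Fin d → S) (i₀ : Fin d) (hT0 : T i₀ = 1)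
    (D : ∀ k : Fin d, k ≠ i₀ → Derivation R S S) (hDa : ∀ k hk i j, D k hk (a i j) = 0)
    (hDT : ∀ k hk i, D k hk (T i) = if i = k then 1 else 0)
    (β : Fin d → S) (hβ : ∑ k, β k * ∑ j, (a k j + a j k) * T j = 1)
    (P : Ideal S) [P.IsPrime] {s : S} (hsq : s * ∑ i, ∑ j, a i j * T i * T j ∈ P ^ 2) : s ∈ P := by
  classical
  by_contra hs
  have hq : ∑ i, ∑ j, a i j * T i * T j ∈ P := by
    have : s * ∑ i, ∑ j, a i j * T i * T j ∈ P := Ideal.pow_le_self two_ne_zero hsq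
    exact (Ideal.IsPrime.mem_or_mem ‹_› this).resolve_left hs
  -- the polars `L_k`, `k ≠ i₀`, lie in `P`
  have hL : ∀ k : Fin d, k ≠ i₀ → ∑ j, (a k j + a j k) * T j ∈ P := by
    intro k hk
    have h := (mem_and_derivation_mem_of_mul_mem_sq (D k hk) P hs hsq).2
    rwa [derivation_quad (D k hk) a T (hDa k hk) k (hDT k hk)] at h
  -- and so does `L_{i₀}`, by Euler
  have hL0 : ∑ j, (a i₀ j + a j i₀) * T j ∈ P := by
    have heu := euler_quad a T
    rw [← Finset.add_sum_erase Finset.univ _ (Finset.mem_univ i₀), hT0, one_mul] at heu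
    have : ∑ j, (a i₀ j + a j i₀) * T j =
        2 * (∑ i, ∑ j, a i j * T i * T j) - ∑ k ∈ Finset.univ.erase i₀, T k * ∑ j, (a k j + a j k) * T j := by
      rw [← heu]; ring
    rw [this]
    refine Ideal.sub_mem _ (Ideal.mul_mem_left _ _ hq) (Ideal.sum_mem _ fun k hk => ?_)
    exact Ideal.mul_mem_left _ _ (hL k (Finset.ne_of_mem_erase hk))
  have hall : ∀ k, ∑ j, (a k j + a j k) * T j ∈ P := fun k => by
    by_cases hk : k = i₀
    · rw [hk]; exact hL0
    · exact hL k hk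
  have h1 : (1 : S) ∈ P := by
    rw [← hβ]
    exact Ideal.sum_mem _ fun k _ => Ideal.mul_mem_left _ _ (hall k)
  exact (Ideal.IsPrime.ne_top ‹_›) ((Ideal.eq_top_iff_one _).mpr h1)

end Quad

/-! ## §3 Small bookkeeping for the chart of a point blowing up -/

section Ring

variable {K : Type u} [Field K]

/-- **The transform along `O` in the chart of ANY nonzero `x ∈ 𝔪_R` of minimal value** is `(R[𝔪_R/x])_{𝔪_O ∩ R[𝔪_R/x]}` (the definition,
with the generating set `insert x s`). [folklore] -/
theorem isQuadraticTransformAlong_chart {O : ValuationSubring K} {R : Subring K} [IsLocalRing R] [IsNoetherianRing R]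
    (hRO : R ≤ O.toSubring) (x : R) (hx : x ∈ maximalIdeal R) (hx0 : x ≠ 0)
    (hmin : ∀ y ∈ maximalIdeal R, O.valuation (y : K) ≤ O.valuation (x : K)) :
    IsQuadraticTransformAlong O R (locAtCentre (blowupRing R (x : K)) O) := by
  classical
  obtain ⟨s, hs⟩ := (IsNoetherian.noetherian (maximalIdeal R))
  have hs' : Ideal.span (s : Set R) = maximalIdeal R := hs
  have hspan : Ideal.span (↑(insert x s) : Set R) = maximalIdeal R := by
    rw [Finset.coe_insert, Ideal.span_insert, hs', sup_eq_right]
    exact (Ideal.span_singleton_le_iff_mem _).mpr hx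
  refine ⟨‹_›, hRO, insert x s, x, hspan, Finset.mem_insert_self _ _, hx0, ?_, ?_⟩
  · intro y hy
    exact hmin y (hspan ▸ Ideal.subset_span (Finset.mem_coe.mpr hy))
  · rw [blowupRing_eq_closure_of_span_eq (x : K) _ hspan]

/-- A member of a regular system of parameters of a regular local ring is nonzero. [cite: Matsumura1987, Thm. 14.2] -/
theorem rsop_ne_zero {R : Type u} [CommRing R] [IsRegularLocalRing R] {d : ℕ} (hd : (maximalIdeal R).spanFinrank = d)
    (t : Fin d → R) (ht : Ideal.span (Set.range t) = maximalIdeal R) (i : Fin d) : t i ≠ 0 := by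
  intro h0
  have := not_mem_span_image_of_not_mem hd t ht (S := ∅) (i := i) (Set.notMem_empty i)
  rw [Set.image_empty, Ideal.span_empty, h0] at this
  exact this (Submodule.zero_mem ⊥)

/-- Pull-back of a square along a ring isomorphism (for the transport through `R[𝔪/x]/(x) ≅ κ[T̃]`). [folklore] -/
theorem symm_mem_sq_comap {A S : Type*} [CommRing A] [CommRing S] (e : A ≃+* S) (N : Ideal S) {z : S}
    (hz : z ∈ N ^ 2) : e.symm z ∈ (N.comap e.toRingHom) ^ 2 := by
  rw [pow_two] at hz ⊢
  refine Submodule.mul_induction_on hz (fun u hu w hw => ?_) (fun y y' hy hy' => ?_)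
  · rw [map_mul]
    refine Ideal.mul_mem_mul ?_ ?_
    · rw [Ideal.mem_comap]; simpa using hu
    · rw [Ideal.mem_comap]; simpa using hw
  · rw [map_add]; exact Ideal.add_mem _ hy hy'

end Ring

end Summit.ResolutionOfSingularities.ResolutionOfSingularities.Theorems.RadicialJung.CleanModels.ConeExit

end
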